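import Literature.AlgebraicGeometry.HodgeTheory.FermatCurveJacobianCMType
import Literature.AlgebraicGeometry.Motives.JacobianExistenceComplex
import HarnessLib

/-!
# `HC_CM ⟹ HC(Xⁿₘ)` for every complex Fermat variety, modulo Shioda–Katsura's lift ALONE

Topic `Literature/AlgebraicGeometry/HodgeTheory`, sequel of `FermatHodgeOfCMHodgeHypothesis`
(binders `hJ`, `hSK`, `hJex`) and `FermatCurveJacobianCMType` (`hJ` discharged). PROOF FILE:
theorems only — no definition, no named fact, sorry-free (D-0026). Written by the literature seat
`pub-hodgecm-conseq` (CONSEQUENCES.md §26 of `run/shared/lean/pub/pub-hodgecm/`).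

The edge «Hodge conjecture for CM abelian varieties (Milne's hypothesis (H), *Compositio Math.*
117 (1999), hypothesis of Thm. 7.1, p. 72: `∀ A, CMHodgeHypothesisAt A`) ⟹ Hodge conjecture for
every complex Fermat variety `Xⁿₘ`» of `FermatHodgeOfCMHodgeHypothesis` carried THREE binders. Two
are now theorems of the tree:

* `hJ` (Jacobians of Fermat curves are of CM type; Koblitz–Rohrlich, *Canad. J. Math.* 30 (1978)
  §1 pp. 1183–1184) = `isOfCMType_jacobian_fermatCurve` (`FermatCurveJacobianCMType`);
* `hJex` (Jacobians exist; Milne, *Jacobian Varieties*, Thm. 1.1) is used there only at `k = ℂ`,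
  where it is the theorem `Motives.nonempty_jacobian_of_isSmoothProjective_complex`
  (`Motives/JacobianExistenceComplex`: Serre's criterion + `2 dim A ≤ b₁(C)`).

This file re-runs the three steps (2)–(4) of `FermatHodgeOfCMHodgeHypothesis` with both inputs fed,
so that the edge stands **modulo the single record `hSK : FermatHodgeClassesLiftToCurvePowersSum`**
(Shioda–Katsura's inductive structure in Hodge-class form, *Tôhoku Math. J.* 31 (1979) Thm. 1.7,
Prop. 2.4 (2.5); a named fact of the tree, the business of the Fermat units):

* `mem_algebraicClasses_fermatCurvePow_of_cmHodgeHypothesis'` — (H) ⟹ every rational `(q,q)`-class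
  on a power `C_mᴷ` of the standard Fermat curve is algebraic (Abel–Jacobi lift to `J(C_m)ᴺ⁺¹`,
  the tree's theorem `CurvePowerHodgeClassesLiftToJacobianPowers_holds`, and (H) at the CM abelian
  variety `J(C_m)ᴺ⁺¹`);
* `mem_algebraicClasses_fermatHypersurface_of_cmHodgeHypothesis'` — (H) + `hSK` ⟹ every rational
  `(p,p)`-class on `V₊(Σ xᵢᵐ) ⊂ ℙⁿ⁺¹`, `m, n ≥ 1`, is algebraic;
* `hodgeConjectureFor_fermat_of_cmHodgeHypothesis_of_liftSum_pos` — (H) + `hSK` ⟹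
  `HodgeConjectureFor n X` for every smooth projective `X` with `IsFermatVariety n m X`, `m ≥ 1`;
* `hodgeFermatVarieties_of_cmHodgeHypothesis_of_liftSum` — the same for every `m` (`m = 0` is
  vacuous), i.e. LITERALLY the body of the route item
  `Summit.….Theses.PadicSemiregularLift.HodgeFermatVarieties` (stmt-HodgeConjecture-1334) from
  (H) (= the route item `RankFourFaces.CMAbelianHodge`, stmt-HodgeConjecture-3052) and `hSK`;
* `hodgeConjectureFor_curvePow_of_cmHodgeHypothesis`, `hodgeConjectureFor_fermatCurvePow_of_cmHodgeHypothesis`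
  — with NO record: (H) ⟹ HC for every power `Cᴺ⁺¹` of a complex curve with CM Jacobian, in
  particular of every Fermat curve (Shioda's products `∏ X¹ₘ`, Math. Ann. 245 (1979) Thm. IV, `rᵢ = 1`).

Relies on: unproved: `FermatHodgeClassesLiftToCurvePowersSum` (as the explicit hypothesis `hSK`,
never instantiated here). Axioms `propext`, `Classical.choice`, `Quot.sound`.

## References

* [Milne1999] J. S. Milne, Lefschetz motives and the Tate conjecture, Compositio Math. 117 (1999),
  §7 Thm. 7.1 (hypothesis), p. 72; §2 p. 54.
* [KoblitzRohrlich1978] N. Koblitz, D. Rohrlich, Simple factors in the Jacobian of a Fermat curve,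
  Canad. J. Math. 30 (1978), §1 pp. 1183–1184.
* [ShiodaKatsura1979] T. Shioda, T. Katsura, On Fermat varieties, Tôhoku Math. J. 31 (1979),
  §1 Thm. 1.7, §2 Lemma 2.1, Prop. 2.4 (2.5).
* [Shioda1979HodgeFermat] T. Shioda, The Hodge conjecture for Fermat varieties, Math. Ann. 245
  (1979), Thm. I.
* [Milne1986JacobianVarieties] J. S. Milne, Jacobian varieties (1986), Thm. 1.1.
* [Voisin2002] C. Voisin, Hodge Theory and Complex Algebraic Geometry I (2002), Lemma 7.28.
-/

noncomputable section

open CategoryTheory AlgebraicGeometry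

namespace Literature.AlgebraicGeometry.HodgeTheory

open Literature.AlgebraicGeometry Literature.AlgebraicGeometry.Motives
open Literature.AlgebraicTopology.SingularHomology

/-! ### (2') One host: powers of the standard Fermat curve, no binders -/

/-- **One host, from (H) alone.** If the Hodge conjecture holds for every complex abelian variety of
CM-type (`∀ A, CMHodgeHypothesisAt A`), every rational `(q,q)`-class `a` on a power
`C_mᴷ = (fermatHypersurface 1 m).pow K` of the standard Fermat curve, `m ≥ 1`, is algebraic:
`C_m` HAS a Jacobian (`nonempty_jacobian_of_isSmoothProjective_complex`), which is of CM type
(`isOfCMType_jacobian_fermatCurve`, Koblitz–Rohrlich), so (H) holds at `J(C_m)ᴺ⁺¹`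
(`forall_hodgeFermatJacobianPowers_of_cmHodgeHypothesis'`), and Hodge classes of `C_mᴺ⁺¹` lift to
`J(C_m)ᴺ⁺¹` up to algebraic classes (`CurvePowerHodgeClassesLiftToJacobianPowers_holds`); `K = 0` is
a point. The theorem `mem_algebraicClasses_fermatCurvePow_of_cmHodgeHypothesis` with `hJ` and `hJex`
fed. [cite: Milne1999, §7 Thm. 7.1 hypothesis (p. 72)] [cite: KoblitzRohrlich1978, §1 pp. 1183–1184]
[cite: Milne1986JacobianVarieties, Thm. 1.1] -/
theorem mem_algebraicClasses_fermatCurvePow_of_cmHodgeHypothesis'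
    (hCM : ∀ A : AbelianVariety ℂ, Milne1999.CMHodgeHypothesisAt A)
    {m : ℕ} (hm : 1 ≤ m) (K q : ℕ) (a : complexBetti ((fermatHypersurface 1 m).pow K) (2 * q))
    (ha : IsRationalClass a) (haH : IsOfHodgeType K ((fermatHypersurface 1 m).pow K) (2 * q) q q a) :
    a ∈ algebraicClasses ((fermatHypersurface 1 m).pow K) q := by
  cases K with
  | zero =>
    have h0 : IsSmoothProjective 0 ((fermatHypersurface 1 m).pow 0) := isSmoothProjective_unit_holds ℂ
    rw [algebraicClasses_eq_top_of_eq_zero_or_le h0 (Or.inr (Nat.zero_le q))]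
    exact Submodule.mem_top
  | succ N =>
    have hC : IsSmoothProjective 1 (fermatHypersurface 1 m) :=
      isSmoothProjective_fermatHypersurface le_rfl hm
    have hCF : IsFermatVariety 1 m (fermatHypersurface 1 m) := isFermatVariety_fermatHypersurface hm
    obtain ⟨𝒥⟩ := nonempty_jacobian_of_isSmoothProjective_complex (fermatHypersurface 1 m) hC
    have HJ : HodgeConjectureFor (𝒥.J.powSucc N).dim (𝒥.J.powSucc N).X :=
      forall_hodgeFermatJacobianPowers_of_cmHodgeHypothesis' hCM m _ 𝒥 hCF hC N
    obtain ⟨G, hGalg, hGlift⟩ :=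
      CurvePowerHodgeClassesLiftToJacobianPowers_holds (fermatHypersurface 1 m) hC 𝒥 N q
    obtain ⟨b, hbrat, hbpp, hdiff⟩ := hGlift a ha haH
    have hb : b ∈ algebraicClasses (𝒥.J.powSucc N).X q := HJ.2 q b hbrat hbpp
    have hGb : G b ∈ algebraicClasses ((fermatHypersurface 1 m).pow (N + 1)) q := hGalg b hb
    have := Submodule.add_mem _ hdiff hGb
    rwa [sub_add_cancel] at this

/-! ### (3') The standard model `V₊(Σ xᵢᵐ)`, modulo `hSK` -/

/-- **The standard model, from (H) and `hSK`.** Under (H) and Shioda–Katsura's inductive structure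
in Hodge-class form (`hSK : FermatHodgeClassesLiftToCurvePowersSum`), every rational `(p,p)`-class on
`V₊(Σᵢ xᵢᵐ) ⊂ ℙⁿ⁺¹_ℂ`, `m, n ≥ 1`, is algebraic (`c = Σᵢ Fᵢ aᵢ`, each `aᵢ` on a host `C_m^{kᵢ}`
algebraic by (2')). The theorem `mem_algebraicClasses_fermatHypersurface_of_cmHodgeHypothesis` with
`hJ` and `hJex` fed. [cite: ShiodaKatsura1979, §1 Thm. 1.7 and §2 Lemma 2.1, Prop. 2.4 (2.5)]
[cite: Shioda1979HodgeFermat, Thm. I] [cite: Milne1999, §7 Thm. 7.1 hypothesis (p. 72)] -/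
theorem mem_algebraicClasses_fermatHypersurface_of_cmHodgeHypothesis'
    (hCM : ∀ A : AbelianVariety ℂ, Milne1999.CMHodgeHypothesisAt A)
    (hSK : FermatHodgeClassesLiftToCurvePowersSum)
    {m n : ℕ} (hm : 1 ≤ m) (hn : 1 ≤ n) (p : ℕ) (c : complexBetti (fermatHypersurface n m) (2 * p))
    (hc : IsRationalClass c) (hpp : IsOfHodgeType n (fermatHypersurface n m) (2 * p) p p c) :
    c ∈ algebraicClasses (fermatHypersurface n m) p := by
  obtain ⟨ι, _, k, q, F, hFalg, hFlift⟩ := hSK m n p hm hn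
  obtain ⟨a, ha, rfl⟩ := hFlift c hc hpp
  exact Submodule.sum_mem _ fun i _ ↦ hFalg i _
    (mem_algebraicClasses_fermatCurvePow_of_cmHodgeHypothesis' hCM hm (k i) (q i) (a i)
      (ha i).1 (ha i).2)

/-! ### (4') Every Fermat variety, modulo `hSK` -/

/-- **(H) ⟹ the Hodge conjecture for every complex Fermat variety of positive degree, modulo
Shioda–Katsura's lift alone.** If the Hodge conjecture holds for all complex abelian varieties of
CM-type (Milne 1999 Thm. 7.1's hypothesis; the Summits item `CMAbelianHodge`), then — granted
`hSK : FermatHodgeClassesLiftToCurvePowersSum` — `HodgeConjectureFor n X` for every smooth projective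
complex `X` with `IsFermatVariety n m X`, every `n`, every `m ≥ 1` (Hodge model:
`nonempty_hodgeModel_holds`; `n = 0` unconditional; `n ≥ 1` by transport along
`X ≅ V₊(Σ xᵢᵐ)` and (3')). The theorem `hodgeConjectureFor_fermat_of_cmHodgeHypothesis` with BOTH
`hJ` (`isOfCMType_jacobian_fermatCurve`) and `hJex` (`nonempty_jacobian_of_isSmoothProjective_complex`)
fed. [cite: Milne1999, §7 Thm. 7.1 hypothesis (p. 72)] [cite: KoblitzRohrlich1978, §1 pp. 1183–1184]
[cite: ShiodaKatsura1979, §1 Thm. 1.7 and §2 Prop. 2.4 (2.5)] [cite: Shioda1979HodgeFermat, Thm. I]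
[cite: Milne1986JacobianVarieties, Thm. 1.1] -/
theorem hodgeConjectureFor_fermat_of_cmHodgeHypothesis_of_liftSum_pos
    (hCM : ∀ A : AbelianVariety ℂ, Milne1999.CMHodgeHypothesisAt A)
    (hSK : FermatHodgeClassesLiftToCurvePowersSum) :
    ∀ (n m : ℕ) (X : SchemeOver ℂ), 1 ≤ m → IsFermatVariety n m X → IsSmoothProjective n X →
      HodgeConjectureFor n X := by
  intro n m X hm hF hX
  refine ⟨nonempty_hodgeModel_holds hX, fun p c hc hpp => ?_⟩
  rcases Nat.eq_zero_or_pos n with rfl | hn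
  · exact hodgeClasses_algebraic_fermat_of_dim_le_one (by omega) hX p c
  -- transport to the standard model `V₊(Σ xᵢᵐ)`
  have hX' : IsSmoothProjective n (fermatHypersurface n m) := isSmoothProjective_fermatHypersurface hn hm
  let e : X ≅ fermatHypersurface n m := hF.isoFermatHypersurface
  set c' : complexBetti (fermatHypersurface n m) (2 * p) :=
    singularCohomology.map ℂ ℂ (Motives.AlgPoints.mapContinuous (L := ℂ) e.inv) (2 * p) c with hc'
  have hc'rat : IsRationalClass c' := hc.map _
  have hc'pp : IsOfHodgeType n (fermatHypersurface n m) (2 * p) p p c' := hpp.map_of_iso e.symm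
  have hc'alg : c' ∈ algebraicClasses (fermatHypersurface n m) p :=
    mem_algebraicClasses_fermatHypersurface_of_cmHodgeHypothesis' hCM hSK hm hn p c' hc'rat hc'pp
  have := mem_algebraicClasses_map_of_iso hX' hX e hc'alg
  rwa [hc', show complexBetti.map e.hom (2 * p)
      (singularCohomology.map ℂ ℂ (Motives.AlgPoints.mapContinuous (L := ℂ) e.inv) (2 * p) c) = c from
    map_hom_map_inv_apply e (2 * p) c] at this

/-- **`HC_CM ⟹ HC(Xⁿₘ)` for every `n` and EVERY `m`, modulo `hSK` alone** (`m = 0`: `V₊(n + 2) = ∅`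
is not smooth projective, `elim_of_isFermatVariety_zero`) — literally the body of the route item
`Theses.PadicSemiregularLift.HodgeFermatVarieties` (stmt-HodgeConjecture-1334) from (H) (the route
item `RankFourFaces.CMAbelianHodge`, stmt-HodgeConjecture-3052) and the single record
`FermatHodgeClassesLiftToCurvePowersSum`. [cite: Milne1999, §7 Thm. 7.1 hypothesis (p. 72)]
[cite: ShiodaKatsura1979, §1 Thm. 1.7 and §2 Prop. 2.4 (2.5)] [cite: KoblitzRohrlich1978, §1 pp. 1183–1184] -/
theorem hodgeFermatVarieties_of_cmHodgeHypothesis_of_liftSum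
    (hCM : ∀ A : AbelianVariety ℂ, Milne1999.CMHodgeHypothesisAt A)
    (hSK : FermatHodgeClassesLiftToCurvePowersSum) :
    ∀ (n m : ℕ) (X : SchemeOver ℂ), IsFermatVariety n m X → IsSmoothProjective n X →
      HodgeConjectureFor n X := by
  intro n m X hF hX
  rcases Nat.eq_zero_or_pos m with rfl | hm
  · exact elim_of_isFermatVariety_zero hF hX _
  · exact hodgeConjectureFor_fermat_of_cmHodgeHypothesis_of_liftSum_pos hCM hSK n m X hm hF hX

/-! ### (5') No record at all: powers of curves with CM Jacobian, powers of Fermat curves -/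

/-- **(H) ⟹ the Hodge conjecture for every power `Cᴺ⁺¹` of a smooth projective complex curve whose
Jacobian is of CM type** — no record: `Cᴺ⁺¹` is smooth projective (`isSmoothProjective_pow_succ_of_curve`),
its rational Hodge classes lift to `J(C)ᴺ⁺¹` up to algebraic classes (Abel–Jacobi, the tree's THEOREM
`CurvePowerHodgeClassesLiftToJacobianPowers_holds`), and `J(C)ᴺ⁺¹` is a CM abelian variety
(`isOfCMType_powSucc`), where (H) applies (`hodgeConjectureFor_powSucc_of_cmHodgeHypothesis`).
(Deligne–Milne, LNM 900 II, Prop. 6.14 `h(C) = 1 ⊕ h¹(J) ⊕ L` — «the map `X → J` defines an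
isomorphism `H¹(J) → H¹(X)`» — and Cor. 6.27 for products.) [cite: Milne1999, §7 Thm. 7.1 hypothesis (p. 72) and §2 p. 54]
[cite: Deligne1982HodgeCycles, II Prop. 6.14 and Cor. 6.27] -/
theorem hodgeConjectureFor_curvePow_of_cmHodgeHypothesis
    (hCM : ∀ A : AbelianVariety ℂ, Milne1999.CMHodgeHypothesisAt A)
    {C : SchemeOver ℂ} (hC : IsSmoothProjective 1 C) (𝒥 : Jacobian C)
    (hJ : Milne1999.IsOfCMType 𝒥.J) (N : ℕ) :
    HodgeConjectureFor (N + 1) (C.pow (N + 1)) := by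
  refine ⟨nonempty_hodgeModel_holds (isSmoothProjective_pow_succ_of_curve hC N), fun q a ha haH => ?_⟩
  have HJ : HodgeConjectureFor (𝒥.J.powSucc N).dim (𝒥.J.powSucc N).X :=
    hodgeConjectureFor_powSucc_of_cmHodgeHypothesis hCM hJ N
  obtain ⟨G, hGalg, hGlift⟩ := CurvePowerHodgeClassesLiftToJacobianPowers_holds C hC 𝒥 N q
  obtain ⟨b, hbrat, hbpp, hdiff⟩ := hGlift a ha haH
  have hGb : G b ∈ algebraicClasses (C.pow (N + 1)) q := hGalg b (HJ.2 q b hbrat hbpp)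
  have := Submodule.add_mem _ hdiff hGb
  rwa [sub_add_cancel] at this

/-- **(H) ⟹ the Hodge conjecture for every power `Cᴺ⁺¹` of every complex Fermat curve `C`** (every
degree `m`; `m = 0` vacuous) — NO record: the Jacobian exists (`nonempty_jacobian_of_isSmoothProjective_complex`)
and is of CM type (`isOfCMType_jacobian_fermatCurve`, Koblitz–Rohrlich). The case `rᵢ = 1` of Shioda's
products `∏ᵢ X^{rᵢ}_m` (Math. Ann. 245 (1979) Thm. IV). [cite: Milne1999, §7 Thm. 7.1 hypothesis (p. 72)]
[cite: KoblitzRohrlich1978, §1 pp. 1183–1184] [cite: Shioda1979HodgeFermat, Thm. IV] -/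
theorem hodgeConjectureFor_fermatCurvePow_of_cmHodgeHypothesis
    (hCM : ∀ A : AbelianVariety ℂ, Milne1999.CMHodgeHypothesisAt A)
    {m : ℕ} {C : SchemeOver ℂ} (hF : IsFermatVariety 1 m C) (hC : IsSmoothProjective 1 C) (N : ℕ) :
    HodgeConjectureFor (N + 1) (C.pow (N + 1)) := by
  obtain ⟨𝒥⟩ := nonempty_jacobian_of_isSmoothProjective_complex C hC
  exact hodgeConjectureFor_curvePow_of_cmHodgeHypothesis hCM hC 𝒥
    (isOfCMType_jacobian_fermatCurve m C 𝒥 hF hC) N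

end Literature.AlgebraicGeometry.HodgeTheory

end
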